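import Literature.AlgebraicGeometry.Motives.CurveGeneralDivisorsAtPoints
import Literature.AlgebraicGeometry.Motives.AbelianVarietyDegree
import Literature.NumberTheory.DiophantineGeometry.FunctionFieldGenusEllLeDegreeProofs
import Literature.NumberTheory.DiophantineGeometry.FunctionFieldGenusDegreePosProofs
import HarnessLib

/-!
# The genus of a smooth curve is invariant under extension of the base field
# (Hartshorne III Prop. 9.3 / Görtz–Wedhorn II Cor. 22.91; Stichtenoth Thm. 3.6.3)

For a smooth proper geometrically integral curve `C` over a field `L` and any field extension
`π : Spec L' → Spec L`, the base change `C_{L'} = curveBC C π` has the same genus: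
**`curveGenus_curveBC : g(C_{L'}) = g(C)`** (the genus of `Motives/CurveRiemannRoch`, i.e. the
genus of the function field `L'(C_{L'}) / L'`). For separable (e.g. finite Galois) `L'/L` this is
Stichtenoth's Thm. 3.6.3 (b) on constant field extensions; smoothness makes it hold for every
extension. The proof reads the genus off the asymptotics of `h⁰`:

* `genus_eq_of_ell_nsmul_eq` — two algebraic function fields with divisors `A₀`, `A₁`,
  `deg A₀ > 0` and `ℓ(n A₁) = ℓ(n A₀)` for all `n` have the same genus (and `deg A₁ = deg A₀`):
  Riemann–Roch for large degree (Stichtenoth Thm. 1.5.17, `ell_eq_of_lt_degree_holds`) makes both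
  sides affine in `n`;
* `curveGenus_eq_of_h0_classPullback_eq` — curves `X₁ → X₀` related by a morphism `φ` with
  `h⁰(X₁, φ^*D) = h⁰(X₀, D)` for all `D` have equal genus (multiples `nsmulDivisor` of the divisor of
  a closed point, `h0_eq_ell`);
* `curveGenus_curveBC_eq` — `g(C_{L₁}) = g(C_{L₀})` along `L₀ → L₁` over `K`, from
  `h0_classPullback_whiskerLeft_fieldExt_eq` (`Motives/H0FieldExtension`, cohomology and flat base
  change in degree `0`);
* `h0_classPullback_eq_of_iso`, `curveGenus_eq_of_iso` — invariance under isomorphisms of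
  `L`-curves (`h0_le_h0_pullback` both ways); `curveBCIdIso : C ×_L Spec L ≅ C`,
  `curveGenus_curveBC_id`, and finally `curveGenus_curveBC`.

Everything is proved; no named facts (D-0026). Part of the construction of the Jacobian
(`nonempty_jacobian_of_isSmoothProjective`): the genus `g`, hence `Cᵍ`, `C^{(g)}` and all
Riemann–Roch counts, do not change when the ground field is extended.

## References

* R. Hartshorne, *Algebraic Geometry*, GTM 52 (1977), III Prop. 9.3. [Hartshorne1977]
* U. Görtz, T. Wedhorn, *Algebraic Geometry II* (2023), Cor. 22.91 (p. 388). [GortzWedhorn2023]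
* H. Stichtenoth, *Algebraic Function Fields and Codes*, 2nd ed. (2009), Thm. 1.5.17, Thm. 3.6.3.
  [Stichtenoth2009]
-/

noncomputable section

open CategoryTheory CategoryTheory.Limits AlgebraicGeometry IsLocalRing Order TopologicalSpace
  MonoidalCategory CartesianMonoidalCategory

universe u

/-! ### Function fields: genus from the asymptotics of `ℓ(nA)` -/

namespace Literature.NumberTheory.DiophantineGeometry.AlgFunctionField

/-- **Two function fields with `ℓ(n A₁) = ℓ(n A₀)` for all `n`, `deg A₀ > 0`, have the same genus**:
for `n ≫ 0` Riemann–Roch gives `ℓ(n A₀) = n deg A₀ + 1 − g₀` (Stichtenoth Thm. 1.5.17), so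
`ℓ(n A₁) → ∞`, whence `deg A₁ > 0` and `ℓ(n A₁) = n deg A₁ + 1 − g₁` for `n ≫ 0`; comparing the two
affine functions of `n` gives `deg A₁ = deg A₀` and `g₁ = g₀`. [folklore] -/
theorem genus_eq_of_ell_nsmul_eq {K₀ : Type*} {F₀ : Type*} [Field K₀] [Field F₀] [Algebra K₀ F₀]
    [IsAlgFunctionField K₀ F₀] [IsIntegrallyClosedIn K₀ F₀]
    {K₁ : Type*} {F₁ : Type*} [Field K₁] [Field F₁] [Algebra K₁ F₁]
    [IsAlgFunctionField K₁ F₁] [IsIntegrallyClosedIn K₁ F₁]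
    (A₀ : Divisor K₀ F₀) (A₁ : Divisor K₁ F₁) (hA₀ : 0 < A₀.degree)
    (h : ∀ n : ℕ, ell (n • A₁) = ell (n • A₀)) :
    genus K₁ F₁ = genus K₀ F₀ ∧ A₁.degree = A₀.degree := by
  set g₀ := genus K₀ F₀
  set g₁ := genus K₁ F₁
  set d₀ := A₀.degree
  set d₁ := A₁.degree
  -- `ℓ(n A₀) = n d₀ + 1 − g₀` for `n ≥ 2 g₀`
  have h0 : ∀ n : ℕ, 2 * g₀ ≤ n → (ell (n • A₀) : ℤ) = n * d₀ + 1 - g₀ := by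
    intro n hn
    have hdeg : (n • A₀).degree = n * d₀ := by rw [map_nsmul, nsmul_eq_mul]
    have hlt : 2 * (g₀ : ℤ) - 2 < (n • A₀).degree := by
      rw [hdeg]
      have : (2 * g₀ : ℤ) ≤ n := by exact_mod_cast hn
      nlinarith
    rw [ell_eq_of_lt_degree_holds hlt, hdeg]
  -- `deg A₁ > 0`
  have hd₁ : 0 < d₁ := by
    by_contra hle
    push Not at hle
    -- take `n = 2 g₀ + 2`: `ℓ(n A₀) ≥ 2` but `ℓ(n A₁) ≤ 1`
    set n := 2 * g₀ + 2 with hn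
    have h1 : (ell (n • A₀) : ℤ) = n * d₀ + 1 - g₀ := h0 n (by omega)
    have h2 : (ell (n • A₁) : ℤ) ≤ 1 := by
      rcases (lt_or_eq_of_le hle) with hlt | heq
      · have : (n • A₁).degree < 0 := by
          rw [map_nsmul, nsmul_eq_mul]
          have : (0 : ℤ) < n := by positivity
          exact mul_neg_of_pos_of_neg this hlt
        rw [ell_eq_zero_of_degree_neg this]; norm_num
      · have hdeg : (n • A₁).degree = 0 := by
          rw [map_nsmul, nsmul_eq_mul]
          exact mul_eq_zero_of_right _ heq
        have := ell_le_degree_add_one_holds (n • A₁) (by rw [hdeg])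
        rw [hdeg] at this
        exact_mod_cast this
    rw [h n] at h2
    have : (n : ℤ) * d₀ ≥ n := by nlinarith
    have hn' : (n : ℤ) = 2 * g₀ + 2 := by simp [hn]
    omega
  -- `ℓ(n A₁) = n d₁ + 1 − g₁` for `n ≥ 2 g₁`
  have h1 : ∀ n : ℕ, 2 * g₁ ≤ n → (ell (n • A₁) : ℤ) = n * d₁ + 1 - g₁ := by
    intro n hn
    have hdeg : (n • A₁).degree = n * d₁ := by rw [map_nsmul, nsmul_eq_mul]
    have hlt : 2 * (g₁ : ℤ) - 2 < (n • A₁).degree := by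
      rw [hdeg]
      have : (2 * g₁ : ℤ) ≤ n := by exact_mod_cast hn
      nlinarith
    rw [ell_eq_of_lt_degree_holds hlt, hdeg]
  -- compare at `n = N` and `n = N + 1`, `N = 2 (g₀ + g₁)`
  set N := 2 * (g₀ + g₁) with hN
  have e0 := h0 N (by omega)
  have e0' := h0 (N + 1) (by omega)
  have e1 := h1 N (by omega)
  have e1' := h1 (N + 1) (by omega)
  rw [h N] at e1
  rw [h (N + 1)] at e1'
  have hd : d₁ = d₀ := by
    have := e1'.symm.trans e0'
    have := e1.symm.trans e0
    push_cast at *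
    nlinarith
  refine ⟨?_, hd⟩
  rw [hd] at e1
  have : (g₁ : ℤ) = g₀ := by linarith
  exact_mod_cast this

end Literature.NumberTheory.DiophantineGeometry.AlgFunctionField

namespace Literature.AlgebraicGeometry.Motives

open Literature.AlgebraicGeometry.RelativeSpec

namespace CurvePlaces

open RatFn FieldPoint CartierDivisor Literature.NumberTheory.DiophantineGeometry
  Literature.NumberTheory.DiophantineGeometry.AlgFunctionField

/-! ### Multiples of a divisor -/

section Multiples

variable {K : Type u} [Field K] (C : SchemeOver K) [IsIntegral C.left]
  [SmoothOfRelativeDimension 1 C.hom] [IsProper C.hom]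

/-- `n D` as the sum `D + ⋯ + D`. [folklore] -/
abbrev nsmulDivisor {X : Scheme.{u}} [IsIntegral X] (n : ℕ) (D : CartierDivisor X) : CartierDivisor X :=
  sumDivisor fun _ : Fin n ↦ D

/-- `toDivisor (n D) = n • toDivisor D`. [folklore] -/
theorem toDivisor_nsmulDivisor (n : ℕ) (D : CartierDivisor C.left) :
    toDivisor C (nsmulDivisor n D) = n • toDivisor C D := by
  rw [toDivisor_sumDivisor, Finset.sum_const, Finset.card_univ, Fintype.card_fin]

/-- `h⁰(n D) = ℓ(n • toDivisor D)`. [folklore] -/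
theorem h0_nsmulDivisor [GeometricallyIntegral C.hom] (n : ℕ) (D : CartierDivisor C.left) :
    (nsmulDivisor n D).h0 K = ell (n • toDivisor C D) := by
  rw [h0_eq_ell, toDivisor_nsmulDivisor]

end Multiples

/-! ### Genus from `h⁰`-preserving morphisms -/

section Compare

variable {L₀ : Type u} [Field L₀] (X₀ : SchemeOver L₀) [IsIntegral X₀.left]
  [SmoothOfRelativeDimension 1 X₀.hom] [IsProper X₀.hom] [GeometricallyIntegral X₀.hom]
  {L₁ : Type u} [Field L₁] (X₁ : SchemeOver L₁) [IsIntegral X₁.left]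
  [SmoothOfRelativeDimension 1 X₁.hom] [IsProper X₁.hom] [GeometricallyIntegral X₁.hom]
  (φ : X₁.left ⟶ X₀.left)

/-- **Curves related by an `h⁰`-preserving morphism have the same genus**: if
`h⁰(X₁, φ^*D) = h⁰(X₀, D)` for every Cartier divisor `D` on `X₀` (divisor classes pulled back by
`classPullback`), then `g(X₁) = g(X₀)` — apply `genus_eq_of_ell_nsmul_eq` to the multiples of the
divisor of a closed point of `X₀`. [folklore] -/
theorem curveGenus_eq_of_h0_classPullback_eq
    (H : ∀ D : CartierDivisor X₀.left, (D.classPullback φ).h0 L₁ = D.h0 L₀) :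
    curveGenus X₁ = curveGenus X₀ := by
  -- a closed point of `X₀` and its divisor
  obtain ⟨v⟩ := nonempty_placeOver (K := L₀) (F := X₀.left.functionField)
  set x₀ := pointOfPlace (C := X₀) v
  have hx₀ : x₀ ≠ genericPoint X₀.left := pointOfPlace_ne_genericPoint v
  set D := pointDivisor X₀ hx₀
  set A₀ := toDivisor X₀ D
  have hA₀ : A₀ = Finsupp.single (place X₀ x₀ hx₀) 1 := toDivisor_pointDivisor hx₀
  have hdeg : 0 < A₀.degree := by
    rw [hA₀, Divisor.degree_single, one_mul]
    exact_mod_cast PlaceOver.degree_pos_holds (K := L₀) (place X₀ x₀ hx₀)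
  -- upstairs
  set E := D.classPullback φ
  set A₁ := toDivisor X₁ E
  have hell : ∀ n : ℕ, ell (n • A₁) = ell (n • A₀) := by
    intro n
    rw [← h0_nsmulDivisor X₀ n D, ← h0_nsmulDivisor X₁ n E, ← H]
    exact ((classPullback_sumDivisor_linEquiv φ fun _ : Fin n ↦ D).h0_eq (K := L₁)).symm
  exact (genus_eq_of_ell_nsmul_eq A₀ A₁ hdeg hell).1

end Compare

/-! ### Base change along field extensions -/

section FieldExt

variable {K : Type u} [Field K] (C : SchemeOver K) [IsIntegral C.left]
  [SmoothOfRelativeDimension 1 C.hom] [IsProper C.hom] [GeometricallyIntegral C.hom]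

omit [IsIntegral C.left] [SmoothOfRelativeDimension 1 C.hom] [IsProper C.hom] in
/-- `C_L → Spec L` is geometrically integral. [folklore] -/
instance geometricallyIntegral_curveBC {L : Type u} [Field L] (π : Spec (.of L) ⟶ Spec (.of K)) :
    GeometricallyIntegral (curveBC C π).hom := by
  change GeometricallyIntegral (pullback.snd C.hom π)
  infer_instance

variable {L₀ L₁ : Type u} [Field L₀] [Field L₁] {π₀ : Spec (.of L₀) ⟶ Spec (.of K)}
  {π₁ : Spec (.of L₁) ⟶ Spec (.of K)}

omit [IsIntegral C.left] in
/-- **The genus of a smooth curve is invariant under extension of the base field**: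
`g(C_{L₁}) = g(C_{L₀})` for fields `L₀ → L₁` over `K` (`h⁰` is invariant,
`h0_classPullback_whiskerLeft_fieldExt_eq`; Hartshorne III Prop. 9.3, Stichtenoth Thm. 3.6.3 (b)
for separable constant extensions — here for all extensions since `C` is smooth).
[cite: GortzWedhorn2023, Cor. 22.91 (p. 388)] -/
theorem curveGenus_curveBC_eq (m : Over.mk π₁ ⟶ Over.mk π₀) :
    curveGenus (curveBC C π₁) = curveGenus (curveBC C π₀) :=
  curveGenus_eq_of_h0_classPullback_eq (curveBC C π₀) (curveBC C π₁) (C ◁ m).left fun D ↦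
    h0_classPullback_whiskerLeft_fieldExt_eq C m D

end FieldExt

/-! ### Invariance under isomorphisms -/

section Iso

variable {L : Type u} [Field L] {X₀ X₁ : SchemeOver L} [IsIntegral X₀.left]
  [SmoothOfRelativeDimension 1 X₀.hom] [IsProper X₀.hom] [GeometricallyIntegral X₀.hom]
  [IsIntegral X₁.left] [SmoothOfRelativeDimension 1 X₁.hom] [IsProper X₁.hom] [GeometricallyIntegral X₁.hom]

omit [GeometricallyIntegral X₀.hom] [GeometricallyIntegral X₁.hom] in
/-- `h⁰` is invariant under pullback by an isomorphism of `L`-curves. [folklore] -/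
theorem h0_classPullback_eq_of_iso (e : X₁ ≅ X₀) (D : CartierDivisor X₀.left) :
    (D.classPullback e.hom.left).h0 L = D.h0 L := by
  haveI : IsIso e.hom.left := inferInstance
  haveI : IsIso e.inv.left := inferInstance
  haveI : IsDominant e.hom.left := inferInstance
  haveI : IsDominant e.inv.left := inferInstance
  haveI : e.hom.left.IsOver (Spec (.of L)) := ⟨Over.w e.hom⟩
  haveI : e.inv.left.IsOver (Spec (.of L)) := ⟨Over.w e.inv⟩
  rw [(classPullback_linEquiv_pullback e.hom.left D).h0_eq (K := L)]
  haveI : FiniteDimensional L ((D.pullback e.hom.left).sections L) := by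
    rw [sections_eq_riemannRochSpace]
    exact finiteDimensional_riemannRochSpace_of_isAlgFunctionField _
  haveI : FiniteDimensional L (((D.pullback e.hom.left).pullback e.inv.left).sections L) := by
    rw [sections_eq_riemannRochSpace]
    exact finiteDimensional_riemannRochSpace_of_isAlgFunctionField _
  have h1 : D.h0 L ≤ (D.pullback e.hom.left).h0 L := h0_le_h0_pullback D L e.hom.left
  have h2 : (D.pullback e.hom.left).h0 L ≤ ((D.pullback e.hom.left).pullback e.inv.left).h0 L :=
    h0_le_h0_pullback _ L e.inv.left
  have h3 : ((D.pullback e.hom.left).pullback e.inv.left).h0 L = D.h0 L := by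
    refine LinEquiv.h0_eq (K := L) (SameDivisor.linEquiv ?_)
    refine (pullback_pullback_sameDivisor D e.hom.left e.inv.left).trans ?_
    refine (pullback_congr_sameDivisor D (show e.inv.left ≫ e.hom.left = 𝟙 _ by
      rw [← Over.comp_left, e.inv_hom_id]; rfl)).trans ?_
    exact pullback_id_sameDivisor D
  omega

/-- **Isomorphic `L`-curves have the same genus.** [folklore] -/
theorem curveGenus_eq_of_iso (e : X₁ ≅ X₀) : curveGenus X₁ = curveGenus X₀ :=
  curveGenus_eq_of_h0_classPullback_eq X₀ X₁ e.hom.left (h0_classPullback_eq_of_iso e)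

end Iso

/-! ### The trivial base change `C ×_L Spec L` -/

section Trivial

variable {L : Type u} [Field L] (C : SchemeOver L) [IsIntegral C.left]
  [SmoothOfRelativeDimension 1 C.hom] [IsProper C.hom] [GeometricallyIntegral C.hom]

omit [IsIntegral C.left] [SmoothOfRelativeDimension 1 C.hom] [IsProper C.hom] [GeometricallyIntegral C.hom] in
/-- `C ×_L Spec L ≅ C` (first projection of the pullback along the identity). [folklore] -/
def pullbackIdIso : pullback C.hom (𝟙 (Spec (.of L))) ≅ C.left where
  hom := pullback.fst _ _
  inv := pullback.lift (𝟙 _) C.hom ((Category.id_comp _).trans (Category.comp_id _).symm)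
  hom_inv_id := by
    apply pullback.hom_ext
    · rw [Category.assoc, pullback.lift_fst, Category.comp_id, Category.id_comp]
    · rw [Category.assoc, pullback.lift_snd, Category.id_comp, pullback.condition, Category.comp_id]
  inv_hom_id := pullback.lift_fst _ _ _

/-- `C ×_L Spec L ≅ C` over `L`. [folklore] -/
def curveBCIdIso : curveBC C (𝟙 (Spec (.of L))) ≅ C :=
  Over.isoMk (pullbackIdIso C) (by
    change pullback.fst C.hom (𝟙 _) ≫ C.hom = pullback.snd C.hom (𝟙 _)
    rw [pullback.condition, Category.comp_id])

/-- **`g(C ×_L Spec L) = g(C)`.** [folklore] -/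
theorem curveGenus_curveBC_id : curveGenus (curveBC C (𝟙 (Spec (.of L)))) = curveGenus C :=
  curveGenus_eq_of_iso (curveBCIdIso C)

/-- **`g(C_{L'}) = g(C)` for every field extension `π : Spec L' → Spec L`.** [cite: GortzWedhorn2023, Cor. 22.91 (p. 388)] -/
theorem curveGenus_curveBC {L' : Type u} [Field L'] (π : Spec (.of L') ⟶ Spec (.of L)) :
    curveGenus (curveBC C π) = curveGenus C := by
  rw [← curveGenus_curveBC_id C]
  exact curveGenus_curveBC_eq C (Over.homMk π (Category.comp_id π) : Over.mk π ⟶ Over.mk (𝟙 _))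

end Trivial

end CurvePlaces

end Literature.AlgebraicGeometry.Motives
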